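import Summits.HubbardSuperconductivity.HubbardSuperconductivity.Theorems.AnisotropyChordTransferFibre3TwoHoleGapCert

/-!
# Route `AnisotropyChord` / H0 rotor rung: HOLE₂(.75) at `L = 9` — the assembly modulo the 14 pair certificates

`L = 9` is the first size at which the spectral hypothesis HOLE₂(.75) = `TwoHoleGap L (¾ε₁)` of `gm3_of_hole2` can hold
(`not_twoHoleGap_eight`; typed table: gap₂/ε₁ = .774 at `L = 9`).  With `…Fibre3TwoHoleGapReduce` / `…TwoHoleGapCert` /
`…TwoHoleGapApprox` in the tree, HOLE₂(.75) at `L = 9` is reduced here to FOURTEEN single-pair facts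
`TwoHoleGapRealAt 9 (89/500) 0 s`, `s ∈ reps9` (the `D₄` classes of nonzero separations), each of which is a finite rational
identity check (`TwoHoleCert.twoHoleGapRealAt_of_approxCert` with the rounded-Cholesky data in
pub/hubbard-mechhunt/hubbard-h0-rotor-p1/scratch-g24/cert/cert_L9_*.json — all 14 verified in exact arithmetic, worst row residual
6.3e−5 ≤ δ = 1/500; kernel `decide` is too slow for the 81×81×79 check (probe: L=7 in 37 s, L=9 exhausts a farm node), so the 14 facts
are a `native_decide` / computational-item job):
* `reps9`, `reps9_cover` (every `z ≠ 0` has a `D₄`-image in `reps9`, by `decide`);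
* `three_quarters_eps1_nine_le`: `¾ε₁(9) ≤ 89/500` (`cos(π/9) ≥ 1 − (π/9)²/2`, double angle);
* ★ `twoHoleGap_nine_of_certs`: the 14 pair facts ⇒ `TwoHoleGap 9 (3/4 * eps1 9)`.
Prover seat `hubbard-h0-rotor-p1` g24; helper for stmt-HubbardSuperconductivity-19089 (`--supports`).
-/

set_option linter.dupNamespace false
set_option autoImplicit false

noncomputable section

open scoped BigOperators
open Complex

namespace Summit.HubbardSuperconductivity.HubbardSuperconductivity.Theorems.AnisotropyChord.Transfer.Fibre3

namespace HoleTwoL9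

/-- the 14 `D₄` representatives `(a, b)`, `0 ≤ b ≤ a ≤ 4`, `(a,b) ≠ (0,0)`, of the nonzero separations of the `9 × 9` torus. [folklore] -/
def reps9 : Finset (Tor 9) :=
  {(((1 : ℕ) : ZMod 9), ((0 : ℕ) : ZMod 9)), (((1 : ℕ) : ZMod 9), ((1 : ℕ) : ZMod 9)),
   (((2 : ℕ) : ZMod 9), ((0 : ℕ) : ZMod 9)), (((2 : ℕ) : ZMod 9), ((1 : ℕ) : ZMod 9)), (((2 : ℕ) : ZMod 9), ((2 : ℕ) : ZMod 9)),
   (((3 : ℕ) : ZMod 9), ((0 : ℕ) : ZMod 9)), (((3 : ℕ) : ZMod 9), ((1 : ℕ) : ZMod 9)), (((3 : ℕ) : ZMod 9), ((2 : ℕ) : ZMod 9)),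
   (((3 : ℕ) : ZMod 9), ((3 : ℕ) : ZMod 9)),
   (((4 : ℕ) : ZMod 9), ((0 : ℕ) : ZMod 9)), (((4 : ℕ) : ZMod 9), ((1 : ℕ) : ZMod 9)), (((4 : ℕ) : ZMod 9), ((2 : ℕ) : ZMod 9)),
   (((4 : ℕ) : ZMod 9), ((3 : ℕ) : ZMod 9)), (((4 : ℕ) : ZMod 9), ((4 : ℕ) : ZMod 9))}

/-- every nonzero separation of the `9 × 9` torus has a `D₄`-image in `reps9` (finite check). [folklore] -/
theorem reps9_cover : ∀ z : Tor 9, z ≠ 0 → ∃ s ∈ reps9, s ∈ d4Orbit 9 z := by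
  decide

/-- `¾ε₁(9) ≤ 89/500`, i.e. `cos(2π/9) ≥ .762667` (`cos(π/9) ≥ 1 − (π/9)²/2 ≥ .939`, `cos 2θ = 2cos²θ − 1`). [folklore] -/
theorem three_quarters_eps1_nine_le : 3 / 4 * eps1 9 ≤ (((89 / 500 : ℚ)) : ℝ) := by
  have hpi := Real.pi_lt_d6
  have hpi0 := Real.pi_pos
  have hc : 1 - (Real.pi / 9) ^ 2 / 2 ≤ Real.cos (Real.pi / 9) := Real.one_sub_sq_div_two_le_cos
  have hx : (Real.pi / 9) ^ 2 ≤ 0.1219 := by nlinarith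
  have hc0 : 0.939 ≤ Real.cos (Real.pi / 9) := by linarith
  unfold eps1
  rw [show (2 * Real.pi / ((9 : ℕ) : ℝ)) = 2 * (Real.pi / 9) by push_cast; ring, Real.cos_two_mul]
  push_cast
  nlinarith

/-- ★ **HOLE₂(.75) at `L = 9` from the 14 pair certificates.** [folklore] -/
theorem twoHoleGap_nine_of_certs
    (h : ∀ s ∈ reps9, TwoHoleGapRealAt 9 (((89 / 500 : ℚ)) : ℝ) 0 s) : TwoHoleGap 9 (3 / 4 * eps1 9) :=
  TwoHoleCert.twoHoleGap_of_ratCerts 9 (89 / 500) three_quarters_eps1_nine_le reps9 reps9_cover h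

end HoleTwoL9

end Summit.HubbardSuperconductivity.HubbardSuperconductivity.Theorems.AnisotropyChord.Transfer.Fibre3

end
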